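import Summits.KontsevichZagierPeriods.KontsevichZagierPeriods.Theorems.PentagonInKZ.Negative.WeightFourLinear
import Summits.KontsevichZagierPeriods.KontsevichZagierPeriods.Theorems.PentagonInKZ.Negative.DualityWeightThree

/-!
# `PentagonInKZ` — negative lane, §18e–g: the level-4 pentagon identity of `Φ_χ` is the four
# weight-4 class relations; the crux modulo weight 5

Standing adversary (cdisprove seat, generation 3) on the crux `PentagonInKZ`
(stmt-KontsevichZagierPeriods-11348), continuing `Negative/WeightFourLinear.lean`.

* §18e The universal identities among the level-4 elements of `U𝔞₄ ⊗ R/(deg > 4)`: `D[U] = D[V]`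
  (level 4) and **`10·X = 4D[L₁] - D[W₃₁] - 3D[K₂²] + 4D[L₃]`**, read off Drinfeld's theorem for
  `Φ_KZ` over `ℝ` after SEPARATING WEIGHTS with the scaling endomorphism `σ₂` (`8·T₃ + 16·T₄ = 0 =
  T₃ + T₄`), using `apply_weight_three/four` at `eval` and `ζ(3), ζ(2) ≠ 0`; transported to every
  commutative `ℚ`-algebra by injectivity of base change from `ℚ` (`level4_identities`).
* §18f Hence `pentAt_four_of_shape`: the level-4 pentagon FOLLOWS from the regularised shape,
  `c_{xxy} + c_{xyy} = 0` and the four scalar relations `5α₁ = -2c²`, `10α₃₁ = c²`, `10α₂₂ = 3c²`,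
  `5α₂₁₁ = -2c²` — the converse of `DrinfeldPentagon.apply_weight_four` at level 4.
* §18g For the crux, in EVERY realisation: the four weight-4 class relations of
  `weight_four_content` (`5z₄ = 2z₂²`, `10z₃₁ = z₂²`, `10z₂₂ = 3z₂²`, `5z₂₁₁ = 2z₂²`) give Drinfeld's
  pentagon for `Φ_χ` in ALL levels `N ≤ 4` (`pentAt_le_four_of_weightFour`; levels `≤ 3`
  unconditional by `pentAt_le_three`).  With `weight_four_content` (crux ⇒ relations) this pins the
  THIRD RUNG exactly: modulo weight 5 the crux IS these four class identities — of which duality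
  `z₂₁₁ = z₄` (one move) and the shuffle `z₂² = 2z₂₂ + 4z₃₁` (a dissection) are cheap, leaving the
  STUFFLE `z₂² = 2z₂₂ + z₄` and `z₄ = 4z₃₁` (Hoffman's weight-4 relation) as the first genuinely
  two-dimensional content of `PentagonInKZ`, and the first place a disproof could bite.
-/

noncomputable section

open Literature.NumberTheory.Transcendental

namespace Summit.KontsevichZagierPeriods.FurushoPentagon.PentagonInKZNegative

open Summit.KontsevichZagierPeriods.KontsevichZagierPeriods.Theses.FurushoPentagon (PentagonInKZ)

/-! ## §18e (continued) The identities `D[U] = D[V]` and `10X = 4D[L₁] - D[W₃₁] - 3D[K₂²] + 4D[L₃]` -/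

section Universal

open DrinfeldKohnoTrunc

/-- **The level-4 identities over `ℝ`**, read off Drinfeld's theorem for `Φ_KZ` after separating
the weight-3 and weight-4 parts with the scaling `σ₂` (`8·T₃ + 16·T₄ = 0 = T₃ + T₄`): `D[U] = D[V]`
at level 4 (from `ζ(3)·(D[V] - D[U]) = 0`) and `10·X = 4D[L₁] - D[W₃₁] - 3D[K₂²] + 4D[L₃]` (from
the four weight-4 MZV relations and `ζ(2)² ≠ 0`). [cite: Drinfeld1991, (2.13); BarNatan1998, §3] -/
theorem level4_identities_real :
    pentD ℝ 4 KU = pentD ℝ 4 KV ∧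
      (10 : ℝ) • pentX ℝ 4 = (4 : ℝ) • pentD ℝ 4 KL1 - pentD ℝ 4 K31 - (3 : ℝ) • pentD ℝ 4 K22 +
        (4 : ℝ) • pentD ℝ 4 KL3 := by
  set φ := cruxSeries ℝ KZ.eval simplexZ with hφdef
  have hpent : NCSeries.DrinfeldPentagon φ := by
    rw [hφdef, cruxSeries_eval_eq_drinfeldAssociator simplexZ_agrees]
    exact drinfeldAssociator_pentagon_holds
  have h0 : φ [] = 1 := cruxSeries_nil_eq_one KZ.eval simplexZ isRealisation_eval simplexZ_agrees
  have hx : φ [false] = 0 := cruxSeries_x _ _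
  have hy : φ [true] = 0 := cruxSeries_y _ _
  have hxx : φ [false, false] = 0 := cruxSeries_xx _ _
  have hyy : φ [true, true] = 0 := cruxSeries_yy _ _
  have hyx : φ [true, false] = -φ [false, true] := by rw [hφdef, cruxSeries_yx, cruxSeries_xy, neg_neg]
  have h3 := NCSeries.DrinfeldPentagon.apply_weight_three hpent h0 hx hy
  obtain ⟨h4a, h4b, h4c, h4d⟩ := NCSeries.DrinfeldPentagon.apply_weight_four hpent h0 hx hy hxx hyy hyx
  have hlin := (pentAt_four_iff_of_shape h0 hx hy hxx hyy hyx (cruxSeries_xxx _ _) (cruxSeries_yyy _ _)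
    (by rw [hφdef, cruxSeries_xyx, cruxSeries_xxy]; ring) (by rw [hφdef, cruxSeries_yxx, cruxSeries_xxy])
    (by rw [hφdef, cruxSeries_yxy, cruxSeries_xyy]) (by rw [hφdef, cruxSeries_yyx, cruxSeries_xyy])
    (cruxSeries_xxxx _ _) (cruxSeries_yyyy _ _) (cruxSeries_xxyx _ _) (cruxSeries_xyxx _ _)
    (cruxSeries_yxxx _ _) (cruxSeries_xyyx _ _) (cruxSeries_yxxy _ _) (cruxSeries_yxyx _ _)
    (cruxSeries_yyxx _ _) (cruxSeries_yxyy _ _) (cruxSeries_yyxy _ _) (cruxSeries_yyyx _ _)).mp (hpent 4)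
  rw [pentD_K₂_eq_zero, smul_zero, zero_add] at hlin
  -- scalars
  set c := φ [false, true] with hc
  set p := φ [false, false, true] with hp
  set q := φ [false, true, true] with hq
  set a1 := φ [false, false, false, true] with ha1
  set a31 := φ [false, false, true, true] with ha31
  set a22 := φ [false, true, false, true] with ha22
  set a211 := φ [false, true, true, true] with ha211
  -- the two homogeneous parts
  obtain ⟨T3, hT3⟩ : ∃ T3 : DrinfeldKohnoTrunc ℝ (Fin 4) 4, T3 = p • pentD ℝ 4 KU + q • pentD ℝ 4 KV :=
    ⟨_, rfl⟩
  obtain ⟨T4, hT4⟩ : ∃ T4 : DrinfeldKohnoTrunc ℝ (Fin 4) 4, T4 = a1 • pentD ℝ 4 KL1 + a31 • pentD ℝ 4 K31 +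
      a22 • pentD ℝ 4 K22 + a211 • pentD ℝ 4 KL3 + (c * c) • pentX ℝ 4 := ⟨_, rfl⟩
  have hsum : T3 + T4 = 0 := by
    rw [hT3, hT4]
    refine Eq.trans ?_ hlin
    abel
  -- weight separation by the scaling σ₂
  obtain ⟨σ, hσ⟩ := exists_scaleHom ℝ (Fin 4) 4 (2 : ℝ)
  have hσ3 : σ T3 = (2 * 2 * 2 : ℝ) • T3 := by
    rw [hT3, map_add, _root_.map_smul, _root_.map_smul,
      scale_pentD σ hσ KU (2 * 2 * 2) (fun A B => (map_KU' σ A B).1) (fun A B => (smul_patterns 2 A B).2.1),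
      scale_pentD σ hσ KV (2 * 2 * 2) (fun A B => (map_KU' σ A B).2.1)
        (fun A B => (smul_patterns 2 A B).2.2.1)]
    module
  have hσ4 : σ T4 = (2 * 2 * 2 * 2 : ℝ) • T4 := by
    rw [hT4, map_add, map_add, map_add, map_add, _root_.map_smul, _root_.map_smul, _root_.map_smul, _root_.map_smul,
      _root_.map_smul,
      scale_pentD σ hσ KL1 (2 * 2 * 2 * 2) (map_KL1 σ) (fun A B => (smul_patterns 2 A B).2.2.2.1),
      scale_pentD σ hσ K31 (2 * 2 * 2 * 2) (map_K31 σ) (fun A B => (smul_patterns 2 A B).2.2.2.2.1),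
      scale_pentD σ hσ K22 (2 * 2 * 2 * 2) (map_K22 σ) (fun A B => (smul_patterns 2 A B).2.2.2.2.2.1),
      scale_pentD σ hσ KL3 (2 * 2 * 2 * 2) (map_KL3 σ) (fun A B => (smul_patterns 2 A B).2.2.2.2.2.2),
      scale_pentX σ hσ]
    module
  have hsep : (2 * 2 * 2 : ℝ) • T3 + (2 * 2 * 2 * 2 : ℝ) • T4 = 0 := by
    rw [← hσ3, ← hσ4, ← map_add, hsum, map_zero]
  have hT4zero : T4 = 0 := by
    have hT3' : T3 = -T4 := eq_neg_of_add_eq_zero_left hsum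
    rw [hT3', smul_neg] at hsep
    have h8 : (8 : ℝ) • T4 = 0 := by
      have e : (8 : ℝ) • T4 = -((2 * 2 * 2 : ℝ) • T4) + (2 * 2 * 2 * 2 : ℝ) • T4 := by module
      rw [e, hsep]
    have := congrArg (fun x => (8 : ℝ)⁻¹ • x) h8
    simpa only [inv_smul_smul₀ (show (8 : ℝ) ≠ 0 by norm_num), smul_zero] using this
  have hT3zero : T3 = 0 := by rwa [hT4zero, add_zero] at hsum
  constructor
  · -- weight 3: `p (D[U] - D[V]) = 0`, `p = -ζ(3) ≠ 0`
    have hq' : q = -p := by linear_combination h3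
    rw [hT3, hq', neg_smul, ← sub_eq_add_neg, ← smul_sub] at hT3zero
    have hpne : p ≠ 0 := by
      rw [hp, hφdef, cruxSeries_xxy, neg_ne_zero, simplexZ_agrees [3] (by decide), KZ.eval_of,
        KZ.mzvRep_value_holds]
      exact (multipleZeta_pos_of_isAdmissible_holds (by decide)).ne'
    have := congrArg (fun x => p⁻¹ • x) hT3zero
    simp only [inv_smul_smul₀ hpne, smul_zero] at this
    exact sub_eq_zero.mp this
  · -- weight 4: `c² (10X - 4D₁ + D₃₁ + 3D₂₂ - 4D₃) = 0`, `c = -ζ(2) ≠ 0`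
    have ea1 : 10 * a1 = -4 * (c * c) := by linear_combination 2 * h4a
    have ea31 : 10 * a31 = c * c := by linear_combination h4b
    have ea22 : 10 * a22 = 3 * (c * c) := by linear_combination h4c
    have ea211 : 10 * a211 = -4 * (c * c) := by linear_combination 2 * h4d
    have h10 : (10 : ℝ) • T4 = (c * c) • ((10 : ℝ) • pentX ℝ 4 -
        ((4 : ℝ) • pentD ℝ 4 KL1 - pentD ℝ 4 K31 - (3 : ℝ) • pentD ℝ 4 K22 + (4 : ℝ) • pentD ℝ 4 KL3)) := by
      rw [hT4]
      simp only [smul_add, smul_smul]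
      rw [ea1, ea31, ea22, ea211]
      module
    rw [hT4zero, smul_zero] at h10
    have hcne : c * c ≠ 0 := by
      have hc0 : c ≠ 0 := by
        rw [hc, hφdef, cruxSeries_xy, neg_ne_zero, simplexZ_agrees [2] (by decide), KZ.eval_of,
          KZ.mzvRep_value_holds]
        exact (multipleZeta_pos_of_isAdmissible_holds (by decide)).ne'
      exact mul_ne_zero hc0 hc0
    have := congrArg (fun x => (c * c)⁻¹ • x) h10.symm
    simp only [inv_smul_smul₀ hcne, smul_zero] at this
    exact (sub_eq_zero.mp this)

variable {R : Type} [CommRing R]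

/-- Base change of the weight-4 defect functionals and of the cross term. [folklore] -/
theorem map_level4 {S : Type} [CommRing S] (f : R →+* S) :
    DrinfeldKohnoTrunc.map f (pentD R 4 KL1) = pentD S 4 KL1 ∧
      DrinfeldKohnoTrunc.map f (pentD R 4 K31) = pentD S 4 K31 ∧
      DrinfeldKohnoTrunc.map f (pentD R 4 K22) = pentD S 4 K22 ∧
      DrinfeldKohnoTrunc.map f (pentD R 4 KL3) = pentD S 4 KL3 ∧
      DrinfeldKohnoTrunc.map f (pentX R 4) = pentX S 4 := by
  refine ⟨?_, ?_, ?_, ?_, ?_⟩ <;>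
    simp only [pentD, pentX, KL1, K31, K22, KL3, K₂, map_sub, map_add, map_mul,
      DrinfeldKohnoTrunc.map_smul, DrinfeldKohnoTrunc.map_t, map_ofNat]

/-- **The level-4 identities over every commutative `ℚ`-algebra** (from `ℝ` by injectivity of base
change from `ℚ`, then functoriality). [folklore] -/
theorem level4_identities (R : Type) [CommRing R] [Algebra ℚ R] :
    pentD R 4 KU = pentD R 4 KV ∧
      (10 : R) • pentX R 4 = (4 : R) • pentD R 4 KL1 - pentD R 4 K31 - (3 : R) • pentD R 4 K22 +
        (4 : R) • pentD R 4 KL3 := by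
  obtain ⟨hUV, hX⟩ := level4_identities_real
  have hqUV : pentD ℚ 4 KU = pentD ℚ 4 KV := by
    apply DrinfeldKohnoTrunc.map_injective (Fin 4) 4 (algebraMap ℚ ℝ).injective
    rw [map_pentD_KU, map_pentD_KV]; exact hUV
  obtain ⟨m1, m31, m22, m3, mX⟩ := map_level4 (algebraMap ℚ ℝ)
  have hqX : (10 : ℚ) • pentX ℚ 4 = (4 : ℚ) • pentD ℚ 4 KL1 - pentD ℚ 4 K31 - (3 : ℚ) • pentD ℚ 4 K22 +
      (4 : ℚ) • pentD ℚ 4 KL3 := by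
    apply DrinfeldKohnoTrunc.map_injective (Fin 4) 4 (algebraMap ℚ ℝ).injective
    simp only [map_sub, map_add, DrinfeldKohnoTrunc.map_smul, m1, m31, m22, m3, mX, map_ofNat]
    exact hX
  obtain ⟨n1, n31, n22, n3, nX⟩ := map_level4 (algebraMap ℚ R)
  constructor
  · have h := congrArg (DrinfeldKohnoTrunc.map (ι := Fin 4) (N := 4) (algebraMap ℚ R)) hqUV
    rwa [map_pentD_KU, map_pentD_KV] at h
  · have h := congrArg (DrinfeldKohnoTrunc.map (ι := Fin 4) (N := 4) (algebraMap ℚ R)) hqX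
    simp only [map_sub, map_add, DrinfeldKohnoTrunc.map_smul, n1, n31, n22, n3, nX, map_ofNat] at h
    exact h

/-! ## §18f The level-4 pentagon FROM the four weight-4 relations -/

/-- **The level-4 pentagon holds for every series of regularised shape with `c_{xxy} + c_{xyy} = 0`
and the four weight-4 relations `5α₁ = -2c²`, `10α₃₁ = c²`, `10α₂₂ = 3c²`, `5α₂₁₁ = -2c²`** —
converse of `DrinfeldPentagon.apply_weight_four` at level 4. [cite: BarNatan1998, §3] -/
theorem pentAt_four_of_shape [Algebra ℚ R] {φ : NCSeries Bool R} (hφ : φ [] = 1) (h0 : φ [false] = 0)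
    (h1 : φ [true] = 0) (hff : φ [false, false] = 0) (htt : φ [true, true] = 0)
    (htf : φ [true, false] = -φ [false, true]) (hfff : φ [false, false, false] = 0)
    (httt : φ [true, true, true] = 0) (hftf : φ [false, true, false] = -2 * φ [false, false, true])
    (htff : φ [true, false, false] = φ [false, false, true])
    (htft : φ [true, false, true] = -2 * φ [false, true, true])
    (httf : φ [true, true, false] = φ [false, true, true])
    (hffff : φ [false, false, false, false] = 0) (htttt : φ [true, true, true, true] = 0)
    (hfftf : φ [false, false, true, false] = -3 * φ [false, false, false, true])
    (hftff : φ [false, true, false, false] = 3 * φ [false, false, false, true])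
    (htfff : φ [true, false, false, false] = -φ [false, false, false, true])
    (hfttf : φ [false, true, true, false] =
      -2 * φ [false, false, true, true] - φ [false, true, false, true])
    (htfft : φ [true, false, false, true] =
      -φ [false, true, false, true] - 2 * φ [false, false, true, true])
    (htftf : φ [true, false, true, false] =
      φ [false, true, false, true] + 4 * φ [false, false, true, true])
    (httff : φ [true, true, false, false] = -φ [false, false, true, true])
    (htftt : φ [true, false, true, true] = -3 * φ [false, true, true, true])
    (httft : φ [true, true, false, true] = 3 * φ [false, true, true, true])
    (htttf : φ [true, true, true, false] = -φ [false, true, true, true])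
    (hpq : φ [false, false, true] + φ [false, true, true] = 0)
    (h4a : 5 * φ [false, false, false, true] + 2 * (φ [false, true] * φ [false, true]) = 0)
    (h4b : 10 * φ [false, false, true, true] - φ [false, true] * φ [false, true] = 0)
    (h4c : 10 * φ [false, true, false, true] - 3 * (φ [false, true] * φ [false, true]) = 0)
    (h4d : 5 * φ [false, true, true, true] + 2 * (φ [false, true] * φ [false, true]) = 0) :
    NCSeries.PentAt φ 4 := by
  rw [pentAt_four_iff_of_shape hφ h0 h1 hff htt htf hfff httt hftf htff htft httf hffff htttt hfftf hftff
    htfff hfttf htfft htftf httff htftt httft htttf, pentD_K₂_eq_zero, smul_zero, zero_add]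
  obtain ⟨hUV, hX⟩ := level4_identities R
  rw [hUV, ← add_smul, hpq, zero_smul, zero_add]
  set c := φ [false, true]
  have ea1 : 10 * φ [false, false, false, true] = -4 * (c * c) := by linear_combination 2 * h4a
  have ea31 : 10 * φ [false, false, true, true] = c * c := by linear_combination h4b
  have ea22 : 10 * φ [false, true, false, true] = 3 * (c * c) := by linear_combination h4c
  have ea211 : 10 * φ [false, true, true, true] = -4 * (c * c) := by linear_combination 2 * h4d
  have hu := NCSeries.isUnit_natCast_of_ne_zero (S := R) (n := 10) (by norm_num)
  rw [Nat.cast_ofNat] at hu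
  rw [← hu.smul_left_cancel (y := (0 : DrinfeldKohnoTrunc R (Fin 4) 4)), smul_zero]
  have e : (10 : R) • (φ [false, false, false, true] • pentD R 4 KL1 +
      φ [false, false, true, true] • pentD R 4 K31 + φ [false, true, false, true] • pentD R 4 K22 +
      φ [false, true, true, true] • pentD R 4 KL3 + (c * c) • pentX R 4) =
      (10 * φ [false, false, false, true]) • pentD R 4 KL1 + (10 * φ [false, false, true, true]) • pentD R 4 K31 +
      (10 * φ [false, true, false, true]) • pentD R 4 K22 + (10 * φ [false, true, true, true]) • pentD R 4 KL3 +
      (c * c) • ((10 : R) • pentX R 4) := by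
    simp only [smul_add, smul_smul]
    congr 1
    rw [mul_comm]
  rw [e, ea1, ea31, ea22, ea211, hX]
  module

end Universal

/-! ## §18g The crux modulo weight 5 -/

section Crux4

variable {R : Type} [CommRing R] [Algebra ℚ R] {χ : KZ.FormalRep →+ R} {Z : List ℕ → KZ.FormalRep}

/-- **The four weight-4 class relations give the level-4 pentagon of `Φ_χ`** (in every realisation;
duality at weight 3 is automatic, `chi_Z3_eq_Z21`). [cite: Furusho2011, §2] -/
theorem cruxSeries_pentAt_four_of_weightFour (hχ : IsRealisation R χ) (hZ : AgreesWithSimplex Z)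
    (h4 : 5 * χ (Z [4]) = 2 * χ (Z [2]) ^ 2) (h31 : 10 * χ (Z [3, 1]) = χ (Z [2]) ^ 2)
    (h22 : 10 * χ (Z [2, 2]) = 3 * χ (Z [2]) ^ 2) (h211 : 5 * χ (Z [2, 1, 1]) = 2 * χ (Z [2]) ^ 2) :
    NCSeries.PentAt (cruxSeries R χ Z) 4 :=
  pentAt_four_of_shape (cruxSeries_nil_eq_one χ Z hχ hZ) (cruxSeries_x χ Z) (cruxSeries_y χ Z)
    (cruxSeries_xx χ Z) (cruxSeries_yy χ Z) (by rw [cruxSeries_yx, cruxSeries_xy, neg_neg])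
    (cruxSeries_xxx χ Z) (cruxSeries_yyy χ Z) (by rw [cruxSeries_xyx, cruxSeries_xxy]; ring)
    (by rw [cruxSeries_yxx, cruxSeries_xxy]) (by rw [cruxSeries_yxy, cruxSeries_xyy])
    (by rw [cruxSeries_yyx, cruxSeries_xyy]) (cruxSeries_xxxx χ Z) (cruxSeries_yyyy χ Z)
    (cruxSeries_xxyx χ Z) (cruxSeries_xyxx χ Z) (cruxSeries_yxxx χ Z) (cruxSeries_xyyx χ Z)
    (cruxSeries_yxxy χ Z) (cruxSeries_yxyx χ Z) (cruxSeries_yyxx χ Z) (cruxSeries_yxyy χ Z)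
    (cruxSeries_yyxy χ Z) (cruxSeries_yyyx χ Z)
    (by rw [cruxSeries_xxy, cruxSeries_xyy, chi_Z3_eq_Z21 hχ hZ]; ring)
    (by rw [cruxSeries_xxxy, cruxSeries_xy]; linear_combination -h4)
    (by rw [cruxSeries_xxyy, cruxSeries_xy]; linear_combination h31)
    (by rw [cruxSeries_xyxy, cruxSeries_xy]; linear_combination h22)
    (by rw [cruxSeries_xyyy, cruxSeries_xy]; linear_combination -h211)

/-- **THIRD RUNG: the crux holds modulo weight 5 in every realisation satisfying the four weight-4
class relations** (`5z₄ = 2z₂²`, `10z₃₁ = z₂²`, `10z₂₂ = 3z₂²`, `5z₂₁₁ = 2z₂²`; levels `≤ 3` are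
unconditional).  With `weight_four_content` (the crux forces them) this pins the third rung of
`PentagonInKZ` exactly. [cite: Furusho2011, §2] -/
theorem pentAt_le_four_of_weightFour (hχ : IsRealisation R χ) (hZ : AgreesWithSimplex Z)
    (h4 : 5 * χ (Z [4]) = 2 * χ (Z [2]) ^ 2) (h31 : 10 * χ (Z [3, 1]) = χ (Z [2]) ^ 2)
    (h22 : 10 * χ (Z [2, 2]) = 3 * χ (Z [2]) ^ 2) (h211 : 5 * χ (Z [2, 1, 1]) = 2 * χ (Z [2]) ^ 2) :
    ∀ N ≤ 4, NCSeries.PentAt (cruxSeries R χ Z) N := by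
  intro N hN
  rcases Nat.lt_or_ge N 4 with hlt | hge
  · exact pentAt_le_three hχ hZ N (by omega)
  · obtain rfl : N = 4 := le_antisymm hN hge
    exact cruxSeries_pentAt_four_of_weightFour hχ hZ h4 h31 h22 h211

end Crux4

end Summit.KontsevichZagierPeriods.FurushoPentagon.PentagonInKZNegative
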